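import Summits.AtomisticToContinuum.Crystallization.Theorems.ReggeStarCoercivityDefectFreeCrystallizesRouteBetaFloor
import Summits.AtomisticToContinuum.Crystallization.Theorems.ReggeStarCoercivityDefectFreeCrystallizesDefectVersion
import Summits.AtomisticToContinuum.Crystallization.Theorems.ReggeStarCoercivityDefectFreeCrystallizesAnnulusCount
import Summits.AtomisticToContinuum.Crystallization.Theorems.ReggeStarCoercivityDefectFreeCrystallizesFunnelOfLayered
import Summits.AtomisticToContinuum.Crystallization.Theorems.ReggeStarCoercivityDefectFreeCrystallizesNoFccStarInHcpChart
import Summits.AtomisticToContinuum.Crystallization.Theorems.PalmUnimodularRigidityLayeredLawsSelectHcpTubeMuGSC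
import Mathlib.MeasureTheory.Integral.Lebesgue.Markov

/-!
# THREE CRUXES, ONE FLOOR — the law-level core of line `palm-good-law` closes crux 9226's rigidity core
# (crux `ReggeStarCoercivity.DefectFreeCrystallizes`, item stmt-AtomisticToContinuum-13603; lead c8, merge theorem)

The registered analytic core of line `palm-good-law` (skeleton v27/v28, `stub_funnelDefectFloor`; hypothesis `hcore` below, verbatim)
is the robust LAW-LEVEL funnel floor `hcpE a₀ h₀ + κ·E_P[D] ≤ E_P[h]` over point-stationary rooted hard-core laws a.s. carried by
everywhere-`SetGood` Barlow-charted force-balanced configurations with zero mean virial stress.  This file proves, sorry-free, that the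
SAME statement closes the rigidity half of the sibling crux 9226 `PalmUnimodularRigidity.LayeredLawsSelectHcp` in its `e*`-form: every
MINIMISING (`E_P[h] ≤ e* = ⨅ periodic e(Q)`) point-stationary law a.s. carried by hcp-charted everywhere-`(1/100)`-good configurations
(`HcpLayered`, crux 9226's Defs) has almost surely ZERO congruence defect of its root star against the relaxed reference star
(`starDefect a₀ h₀ μ = 0` — the conclusion of 9226's registered core `stub_hcpTubeRigidity`, which 9226's landed local-congruence chain
turns into "a.s. an exact rotated relaxed hcp crystal").

Ingredients, all LANDED: the class inclusion tube ⊂ funnel (`FunnelOfLayered.stub_funnelOfLayered`, p149307: 45° covering angle of both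
kissing patterns), the hard core of layered point-stationary laws (`ae_isRootedHardCore_of_layered`, 9226), a.s. force balance and zero mean
virial stress of minimising laws (`RouteBetaFloor.ae_forceBalance_of_minimising` / `zeroMeanStress_of_minimising`, p136476 over p135765 p136018
and 9226's μGSC theorems), `e* ≤ hcpE` (`RouteBetaFloor.iInf_le_hcpE`), the measurable versions of the defect (`DefectVersion`, p146247;
`AnnulusCount`, p146063), and the exclusion of the fcc branch under an hcp chart (`NoFccStarInHcpChart.stub_noFccStarInHcpChart`, p150512:
cuboctahedron vs anticuboctahedron bond graphs).  Then `hcpE + κ E_P[Dm] ≤ E_P[h] ≤ e* ≤ hcpE` forces `E_P[Dm] = 0`, `Dm = 0` a.s., hence a.s.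
`min(starDefect, fccDefect) + #annulus = 0`, and the fcc branch is impossible.

So ONE statement item — `stub_funnelDefectFloor` — closes 13603 (with 9226's selection half, `RouteBetaDefectFloor`, p150082) AND 9226's
rigidity core; 14993's `stub_slpLawCoerciveLS` has the same shape on a sub-class.  Note for the planner: the merge needs minimality in the
`e*`-form (force balance and zero mean stress are derived from it); 9226's e*-free stub `stub_hcpTubeRigidity` (hypothesis `E_P[h] ≤ hcpE`)
is reached only once the floor itself gives `E_P[h] ≥ hcpE`, or by dropping the two structure hypotheses from the core (true either way).
All `[folklore]` bookkeeping; no definitions.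
-/

noncomputable section

open scoped BigOperators ENNReal
open Filter Topology MeasureTheory

namespace Summit.AtomisticToContinuum.Crystallization.Theorems.PalmGoodLaw.RouteBetaTubeMerge

open Summit.AtomisticToContinuum.Crystallization.Theses
open Literature.MathematicalPhysics.StatisticalMechanics Literature.Geometry.DiscreteGeometry
open Literature.Probability.Process

/-- hcp-layered laws are layered (the hcp chart is a Barlow chart with the alternating Hägg word; anchor of this file). [folklore] -/
theorem layered_of_hcpLayered : ∀ P : MeasureTheory.Measure (MeasureTheory.Measure (EuclideanSpace ℝ (Fin 3))), Summit.AtomisticToContinuum.Crystallization.Theorems.PalmUnimodularRigidity.LayeredLawsSelectHcp.HcpLayered P → Summit.AtomisticToContinuum.Crystallization.Theorems.LayeredLawsSelectHcp.Negative.DiracLaws.Layered P := by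
  intro P h
  filter_upwards [h] with μ hμ
  obtain ⟨S, hμS, hgood, hch⟩ := hμ
  exact ⟨S, hμS, hgood, alternatingHagg, isHaggSeq_alternating, (Summit.AtomisticToContinuum.Crystallization.Theorems.PalmUnimodularRigidity.LayeredLawsSelectHcp.hcpCharted_iff S).1 hch⟩

/-- **13603's core closes 9226's rigidity core (`e*`-form).**  Under the registered law-level funnel floor `hcore` (verbatim
`stub_funnelDefectFloor`), every minimising point-stationary probability law a.s. carried by hcp-charted everywhere-`(1/100)`-good
configurations has a.s. zero congruence defect of the root star against the relaxed reference `(a₀, h₀)`. [folklore] -/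
theorem starDefect_ae_zero_of_funnelDefectFloor
    (hcore :
    ∀ a₀ h₀ : ℝ, 189 / 200 ≤ a₀ → a₀ ≤ 199 / 200 → 77 / 100 ≤ h₀ → h₀ ≤ 163 / 200 →
      (∀ a h : ℝ, 0 < a → 0 < h →
        Summit.AtomisticToContinuum.Crystallization.Theorems.PalmUnimodularRigidity.LayeredLawsSelectHcp.hcpE a₀ h₀ ≤
          Summit.AtomisticToContinuum.Crystallization.Theorems.PalmUnimodularRigidity.LayeredLawsSelectHcp.hcpE a h) →
      ∀ δ : ℝ, 0 < δ → ∃ κ : ℝ, 0 < κ ∧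
        ∀ Dm : Measure (EuclideanSpace ℝ (Fin 3)) → ℝ≥0∞, Measurable Dm →
          (∀ μ : Measure (EuclideanSpace ℝ (Fin 3)), IsRootedHardCore δ μ →
            Dm μ = ENNReal.ofReal
              (min (Summit.AtomisticToContinuum.Crystallization.Theorems.PalmUnimodularRigidity.LayeredLawsSelectHcp.starDefect a₀ h₀ μ)
                  (⨅ A : EuclideanSpace ℝ (Fin 3) ≃ₗᵢ[ℝ] EuclideanSpace ℝ (Fin 3),
                    ∑ p ∈ fccKissingPattern, Metric.infDist (A (a₀ • p)) (Summit.AtomisticToContinuum.Crystallization.Theorems.PalmUnimodularRigidity.LayeredLawsSelectHcp.rootStar μ) ^ 2) +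
                (μ {y : EuclideanSpace ℝ (Fin 3) | 11 / 10 < ‖y‖ ∧ ‖y‖ ≤ 5 / 4}).toReal)) →
          ∀ P : Measure (Measure (EuclideanSpace ℝ (Fin 3))), IsProbabilityMeasure P →
            (∀ᵐ μ ∂P, IsRootedHardCore δ μ) → IsPointStationaryLaw P →
            (∀ᵐ μ ∂P, ∃ S : Set (EuclideanSpace ℝ (Fin 3)),
              μ = (Measure.count : Measure (EuclideanSpace ℝ (Fin 3))).restrict S ∧
              (∀ y ∈ S, SetGood S y) ∧
              ∃ s : ℤ → ℤ, IsHaggSeq s ∧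
                ∃ Φ : EuclideanSpace ℝ (Fin 3) → EuclideanSpace ℝ (Fin 3),
                  Set.BijOn Φ (barlowStacking 1 (Real.sqrt (2 / 3)) s) S ∧
                  ∀ p ∈ barlowStacking 1 (Real.sqrt (2 / 3)) s, ∀ q ∈ barlowStacking 1 (Real.sqrt (2 / 3)) s,
                    (dist p q = 1 ↔ (0 < dist (Φ p) (Φ q) ∧ dist (Φ p) (Φ q) < 6 / 5))) →
            (∀ᵐ μ ∂P, ∃ S : Set (EuclideanSpace ℝ (Fin 3)),
              μ = (Measure.count : Measure (EuclideanSpace ℝ (Fin 3))).restrict S ∧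
              ∀ p ∈ S, HasSum (fun q : {q : EuclideanSpace ℝ (Fin 3) // q ∈ S ∧ q ≠ p} =>
                (deriv lennardJones (dist p q.1) / dist p q.1) • (p - q.1)) 0) →
            (∀ M : EuclideanSpace ℝ (Fin 3) →L[ℝ] EuclideanSpace ℝ (Fin 3),
              ∫ μ, (∫ y, deriv lennardJones ‖y‖ / ‖y‖ * inner ℝ y (M y) ∂μ) ∂P = 0) →
            Summit.AtomisticToContinuum.Crystallization.Theorems.PalmUnimodularRigidity.LayeredLawsSelectHcp.hcpE a₀ h₀ +
                κ * (∫⁻ μ, Dm μ ∂P).toReal ≤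
              ∫ μ, (∫ y, lennardJones ‖y‖ ∂μ) / 2 ∂P) :
    ∀ a₀ h₀ : ℝ, 189 / 200 ≤ a₀ → a₀ ≤ 199 / 200 → 77 / 100 ≤ h₀ → h₀ ≤ 163 / 200 →
      (∀ a h : ℝ, 0 < a → 0 < h → Summit.AtomisticToContinuum.Crystallization.Theorems.PalmUnimodularRigidity.LayeredLawsSelectHcp.hcpE a₀ h₀ ≤ Summit.AtomisticToContinuum.Crystallization.Theorems.PalmUnimodularRigidity.LayeredLawsSelectHcp.hcpE a h) →
      ∀ P : Measure (Measure (EuclideanSpace ℝ (Fin 3))), IsProbabilityMeasure P →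
        Summit.AtomisticToContinuum.Crystallization.Theorems.LayeredLawsSelectHcp.Negative.DiracLaws.PointStationary P → Summit.AtomisticToContinuum.Crystallization.Theorems.PalmUnimodularRigidity.LayeredLawsSelectHcp.HcpLayered P →
        (∫ μ, (∫ y, lennardJones ‖y‖ ∂μ) / 2 ∂P) ≤ (⨅ Q : PeriodicConfiguration 3, Q.energyPerParticle lennardJones) →
        ∀ᵐ μ ∂P, Summit.AtomisticToContinuum.Crystallization.Theorems.PalmUnimodularRigidity.LayeredLawsSelectHcp.starDefect a₀ h₀ μ = 0 := by
  classical
  intro a₀ h₀ ha₁ ha₂ hh₁ hh₂ hmin P hP hstat hHL hE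
  have ha₀pos : (0 : ℝ) < a₀ := by linarith
  have hh₀pos : (0 : ℝ) < h₀ := by linarith
  -- the structure inputs: layered ⇒ hard core; minimising ⇒ a.s. force balance, zero mean stress; tube ⊂ funnel
  have hL : Summit.AtomisticToContinuum.Crystallization.Theorems.LayeredLawsSelectHcp.Negative.DiracLaws.Layered P := layered_of_hcpLayered P hHL
  have hδ : (0 : ℝ) < 891 / 1000 := by norm_num
  have hhc : ∀ᵐ μ ∂P, IsRootedHardCore (891 / 1000) μ := Summit.AtomisticToContinuum.Crystallization.Theorems.PalmUnimodularRigidity.LayeredLawsSelectHcp.ae_isRootedHardCore_of_layered hstat hL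
  have hstat' : IsPointStationaryLaw P := hstat
  have hFB := RouteBetaFloor.ae_forceBalance_of_minimising hδ hhc hstat' hE
  have hZS := RouteBetaFloor.zeroMeanStress_of_minimising hδ hhc hstat' hE
  have hfun : ∀ᵐ μ ∂P, ∃ S : Set (EuclideanSpace ℝ (Fin 3)),
      μ = (Measure.count : Measure (EuclideanSpace ℝ (Fin 3))).restrict S ∧
      (∀ y ∈ S, SetGood S y) ∧
      ∃ s : ℤ → ℤ, IsHaggSeq s ∧
        ∃ Φ : EuclideanSpace ℝ (Fin 3) → EuclideanSpace ℝ (Fin 3),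
          Set.BijOn Φ (barlowStacking 1 (Real.sqrt (2 / 3)) s) S ∧
          ∀ p ∈ barlowStacking 1 (Real.sqrt (2 / 3)) s, ∀ q ∈ barlowStacking 1 (Real.sqrt (2 / 3)) s,
            (dist p q = 1 ↔ (0 < dist (Φ p) (Φ q) ∧ dist (Φ p) (Φ q) < 6 / 5)) := by
    filter_upwards [hL] with μ hμ
    obtain ⟨S, hμS, hgood, hBL⟩ := hμ
    obtain ⟨hsg, s, hs, Φ, hbij, hiso⟩ := FunnelOfLayered.stub_funnelOfLayered S hgood hBL
    exact ⟨S, hμS, hsg, s, hs, Φ, hbij, hiso⟩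
  obtain ⟨κ, hκ, hcoreP⟩ := hcore a₀ h₀ ha₁ ha₂ hh₁ hh₂ hmin (891 / 1000) hδ
  -- measurable versions of the two star defects (stub V, instantiated twice) and the annulus packing bound (stub A)
  set eH := (Summit.AtomisticToContinuum.Crystallization.Theorems.PalmUnimodularRigidity.LayeredLawsSelectHcp.hcpStarIdx).equivFin with heH
  obtain ⟨Dh, hDh_m, hDh_le, hDh_eq⟩ :=
    DefectVersion.stub_defectVersion _ (fun i => Summit.AtomisticToContinuum.Crystallization.Theorems.PalmUnimodularRigidity.LayeredLawsSelectHcp.hcpSite a₀ h₀ ((eH.symm i : Summit.AtomisticToContinuum.Crystallization.Theorems.PalmUnimodularRigidity.LayeredLawsSelectHcp.hcpStarIdx) : ℤ × ℤ × ℤ)) (891 / 1000) hδ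
  set eF := (fccKissingPattern).equivFin with heF
  obtain ⟨Df, hDf_m, hDf_le, hDf_eq⟩ :=
    DefectVersion.stub_defectVersion _ (fun i => a₀ • ((eF.symm i : fccKissingPattern) : (EuclideanSpace ℝ (Fin 3)))) (891 / 1000) hδ
  obtain ⟨N, hN⟩ := AnnulusCount.stub_annulusCount (891 / 1000) hδ
  -- the annulus event and the measurable version `Dm` of the defect functional
  set ann : Set (EuclideanSpace ℝ (Fin 3)) := {y : (EuclideanSpace ℝ (Fin 3)) | 11 / 10 < ‖y‖ ∧ ‖y‖ ≤ 5 / 4} with hann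
  have hann_m : MeasurableSet ann :=
    (measurableSet_lt measurable_const measurable_norm).inter (measurableSet_le measurable_norm measurable_const)
  set Dm : Measure (EuclideanSpace ℝ (Fin 3)) → ℝ≥0∞ := fun μ => min (Dh μ) (Df μ) + μ ann with hDm
  have hDm_m : Measurable Dm := (hDh_m.min hDf_m).add (Measure.measurable_coe hann_m)
  -- read-backs of the two instantiated sums
  have hsumH : ∀ (A : (EuclideanSpace ℝ (Fin 3)) ≃ₗᵢ[ℝ] (EuclideanSpace ℝ (Fin 3))) (μ : Measure (EuclideanSpace ℝ (Fin 3))),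
      (∑ i, Metric.infDist (A (Summit.AtomisticToContinuum.Crystallization.Theorems.PalmUnimodularRigidity.LayeredLawsSelectHcp.hcpSite a₀ h₀ ((eH.symm i : Summit.AtomisticToContinuum.Crystallization.Theorems.PalmUnimodularRigidity.LayeredLawsSelectHcp.hcpStarIdx) : ℤ × ℤ × ℤ))) (Summit.AtomisticToContinuum.Crystallization.Theorems.PalmUnimodularRigidity.LayeredLawsSelectHcp.rootStar μ) ^ 2) =
        ∑ v ∈ Summit.AtomisticToContinuum.Crystallization.Theorems.PalmUnimodularRigidity.LayeredLawsSelectHcp.hcpStarIdx, Metric.infDist (A (Summit.AtomisticToContinuum.Crystallization.Theorems.PalmUnimodularRigidity.LayeredLawsSelectHcp.hcpSite a₀ h₀ v)) (Summit.AtomisticToContinuum.Crystallization.Theorems.PalmUnimodularRigidity.LayeredLawsSelectHcp.rootStar μ) ^ 2 := by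
    intro A μ
    rw [← Finset.sum_coe_sort Summit.AtomisticToContinuum.Crystallization.Theorems.PalmUnimodularRigidity.LayeredLawsSelectHcp.hcpStarIdx
      (fun v : ℤ × ℤ × ℤ => Metric.infDist (A (Summit.AtomisticToContinuum.Crystallization.Theorems.PalmUnimodularRigidity.LayeredLawsSelectHcp.hcpSite a₀ h₀ v)) (Summit.AtomisticToContinuum.Crystallization.Theorems.PalmUnimodularRigidity.LayeredLawsSelectHcp.rootStar μ) ^ 2)]
    exact Fintype.sum_equiv eH.symm _ _ (fun i => rfl)
  have hsumF : ∀ (A : (EuclideanSpace ℝ (Fin 3)) ≃ₗᵢ[ℝ] (EuclideanSpace ℝ (Fin 3))) (μ : Measure (EuclideanSpace ℝ (Fin 3))),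
      (∑ i, Metric.infDist (A (a₀ • ((eF.symm i : fccKissingPattern) : (EuclideanSpace ℝ (Fin 3))))) (Summit.AtomisticToContinuum.Crystallization.Theorems.PalmUnimodularRigidity.LayeredLawsSelectHcp.rootStar μ) ^ 2) =
        ∑ p ∈ fccKissingPattern, Metric.infDist (A (a₀ • p)) (Summit.AtomisticToContinuum.Crystallization.Theorems.PalmUnimodularRigidity.LayeredLawsSelectHcp.rootStar μ) ^ 2 := by
    intro A μ
    rw [← Finset.sum_coe_sort fccKissingPattern
      (fun p : (EuclideanSpace ℝ (Fin 3)) => Metric.infDist (A (a₀ • p)) (Summit.AtomisticToContinuum.Crystallization.Theorems.PalmUnimodularRigidity.LayeredLawsSelectHcp.rootStar μ) ^ 2)]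
    exact Fintype.sum_equiv eF.symm _ _ (fun i => rfl)
  have hstar : ∀ μ : Measure (EuclideanSpace ℝ (Fin 3)), IsRootedHardCore (891 / 1000) μ →
      Dh μ = ENNReal.ofReal (Summit.AtomisticToContinuum.Crystallization.Theorems.PalmUnimodularRigidity.LayeredLawsSelectHcp.starDefect a₀ h₀ μ) := by
    intro μ hμ
    rw [hDh_eq μ hμ]
    simp_rw [hsumH]
    rfl
  have hfcc : ∀ μ : Measure (EuclideanSpace ℝ (Fin 3)), IsRootedHardCore (891 / 1000) μ →
      Df μ = ENNReal.ofReal (⨅ A : (EuclideanSpace ℝ (Fin 3)) ≃ₗᵢ[ℝ] (EuclideanSpace ℝ (Fin 3)),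
        ∑ p ∈ fccKissingPattern, Metric.infDist (A (a₀ • p)) (Summit.AtomisticToContinuum.Crystallization.Theorems.PalmUnimodularRigidity.LayeredLawsSelectHcp.rootStar μ) ^ 2) := by
    intro μ hμ
    rw [hDf_eq μ hμ]
    simp_rw [hsumF]
  have hann_fin : ∀ μ : Measure (EuclideanSpace ℝ (Fin 3)), IsRootedHardCore (891 / 1000) μ → μ ann ≠ ⊤ := fun μ hμ =>
    ne_top_of_le_ne_top (ENNReal.natCast_ne_top N) (hN μ hμ)
  have hfcc_nonneg : ∀ μ : Measure (EuclideanSpace ℝ (Fin 3)), 0 ≤ ⨅ A : (EuclideanSpace ℝ (Fin 3)) ≃ₗᵢ[ℝ] (EuclideanSpace ℝ (Fin 3)),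
      ∑ p ∈ fccKissingPattern, Metric.infDist (A (a₀ • p)) (Summit.AtomisticToContinuum.Crystallization.Theorems.PalmUnimodularRigidity.LayeredLawsSelectHcp.rootStar μ) ^ 2 :=
    fun μ => Real.iInf_nonneg fun _ => Finset.sum_nonneg fun _ _ => sq_nonneg _
  have hagree : ∀ μ : Measure (EuclideanSpace ℝ (Fin 3)), IsRootedHardCore (891 / 1000) μ →
      Dm μ = ENNReal.ofReal
        (min (Summit.AtomisticToContinuum.Crystallization.Theorems.PalmUnimodularRigidity.LayeredLawsSelectHcp.starDefect a₀ h₀ μ)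
            (⨅ A : (EuclideanSpace ℝ (Fin 3)) ≃ₗᵢ[ℝ] (EuclideanSpace ℝ (Fin 3)),
              ∑ p ∈ fccKissingPattern, Metric.infDist (A (a₀ • p)) (Summit.AtomisticToContinuum.Crystallization.Theorems.PalmUnimodularRigidity.LayeredLawsSelectHcp.rootStar μ) ^ 2) +
          (μ {y : (EuclideanSpace ℝ (Fin 3)) | 11 / 10 < ‖y‖ ∧ ‖y‖ ≤ 5 / 4}).toReal) := by
    intro μ hμ
    have hmono : Monotone ENNReal.ofReal := fun _ _ h => ENNReal.ofReal_le_ofReal h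
    rw [ENNReal.ofReal_add (le_min (Summit.AtomisticToContinuum.Crystallization.Theorems.PalmUnimodularRigidity.LayeredLawsSelectHcp.starDefect_nonneg a₀ h₀ μ) (hfcc_nonneg μ)) ENNReal.toReal_nonneg,
      hmono.map_min, ENNReal.ofReal_toReal (hann_fin μ hμ), hDm]
    simp only
    rw [hstar μ hμ, hfcc μ hμ]
  have hfloor := hcoreP Dm hDm_m hagree P hP hhc hstat' hfun hFB hZS
  -- finiteness of `E_P[Dm]`
  have hbound : ∀ᵐ μ ∂P, Dm μ ≤
      ENNReal.ofReal (∑ i, (‖Summit.AtomisticToContinuum.Crystallization.Theorems.PalmUnimodularRigidity.LayeredLawsSelectHcp.hcpSite a₀ h₀ ((eH.symm i : Summit.AtomisticToContinuum.Crystallization.Theorems.PalmUnimodularRigidity.LayeredLawsSelectHcp.hcpStarIdx) : ℤ × ℤ × ℤ)‖ + 11 / 10) ^ 2) + N := by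
    filter_upwards [hhc] with μ hμ
    exact add_le_add ((min_le_left _ _).trans (hDh_le μ)) (hN μ hμ)
  have hfin : ∫⁻ μ, Dm μ ∂P ≠ ⊤ := by
    refine ne_top_of_le_ne_top ?_ (lintegral_mono_ae hbound)
    rw [lintegral_const, measure_univ, mul_one]
    exact ENNReal.add_ne_top.2 ⟨ENNReal.ofReal_ne_top, ENNReal.natCast_ne_top N⟩
  -- the level: `E_P[h] ≤ e* ≤ hcpE a₀ h₀`, so `E_P[Dm] = 0`
  have hlev : (∫ μ, (∫ y, lennardJones ‖y‖ ∂μ) / 2 ∂P) ≤ Summit.AtomisticToContinuum.Crystallization.Theorems.PalmUnimodularRigidity.LayeredLawsSelectHcp.hcpE a₀ h₀ :=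
    hE.trans (RouteBetaFloor.iInf_le_hcpE ha₀pos.ne' hh₀pos.ne')
  have hX0 : (∫⁻ μ, Dm μ ∂P) = 0 := by
    have h1 : κ * (∫⁻ μ, Dm μ ∂P).toReal ≤ 0 := by linarith
    have h2 : (∫⁻ μ, Dm μ ∂P).toReal ≤ 0 := by
      by_contra h
      push Not at h
      nlinarith
    have h3 : (∫⁻ μ, Dm μ ∂P).toReal = 0 := le_antisymm h2 ENNReal.toReal_nonneg
    rcases (ENNReal.toReal_eq_zero_iff _).1 h3 with h | h
    · exact h
    · exact absurd h hfin
  have hae : ∀ᵐ μ ∂P, Dm μ = 0 := (lintegral_eq_zero_iff hDm_m).1 hX0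
  -- conclusion, almost surely
  filter_upwards [hae, hhc, hHL] with μ h0 hμ hHLμ
  obtain ⟨S, hμS, hgood, hch⟩ := hHLμ
  obtain ⟨S₀, h00, hsep, hμ0⟩ := hμ
  have hmem : ∀ y : EuclideanSpace ℝ (Fin 3), y ∈ S ↔ μ {y} ≠ 0 := fun y => by
    rw [hμS]; exact (count_restrict_singleton_ne_zero_iff S y).symm
  have hmem0 : ∀ y : EuclideanSpace ℝ (Fin 3), y ∈ S₀ ↔ μ {y} ≠ 0 := fun y => by
    rw [hμ0]; exact (count_restrict_singleton_ne_zero_iff S₀ y).symm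
  have h0S : (0 : EuclideanSpace ℝ (Fin 3)) ∈ S := (hmem 0).2 ((hmem0 0).1 h00)
  have hD := hagree μ ⟨S₀, h00, hsep, hμ0⟩
  rw [h0] at hD
  have hle := ENNReal.ofReal_eq_zero.1 hD.symm
  have hmin0 := le_min (Summit.AtomisticToContinuum.Crystallization.Theorems.PalmUnimodularRigidity.LayeredLawsSelectHcp.starDefect_nonneg a₀ h₀ μ) (hfcc_nonneg μ)
  have hann0 : 0 ≤ (μ {y : EuclideanSpace ℝ (Fin 3) | 11 / 10 < ‖y‖ ∧ ‖y‖ ≤ 5 / 4}).toReal := ENNReal.toReal_nonneg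
  have hmin_eq : min (Summit.AtomisticToContinuum.Crystallization.Theorems.PalmUnimodularRigidity.LayeredLawsSelectHcp.starDefect a₀ h₀ μ)
      (⨅ A : EuclideanSpace ℝ (Fin 3) ≃ₗᵢ[ℝ] EuclideanSpace ℝ (Fin 3),
        ∑ p ∈ fccKissingPattern, Metric.infDist (A (a₀ • p)) (Summit.AtomisticToContinuum.Crystallization.Theorems.PalmUnimodularRigidity.LayeredLawsSelectHcp.rootStar μ) ^ 2) = 0 := by
    linarith
  rcases min_eq_iff.1 hmin_eq with ⟨h, -⟩ | ⟨h, -⟩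
  · exact h
  · exfalso
    have hfloor' := NoFccStarInHcpChart.stub_noFccStarInHcpChart a₀ ha₁ ha₂ S h0S (hgood 0 h0S) hch
    rw [← hμS] at hfloor'
    linarith

end Summit.AtomisticToContinuum.Crystallization.Theorems.PalmGoodLaw.RouteBetaTubeMerge

end
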